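import Mathlib

/-!
# KPlusLogSqLaw — the hull facts N2, N4, N5 of the two-speed certificate, as kernel theorems

Setting (route `KPlusLogSqLaw`, crux `TropicalB`, realisable model law `HullDComb` of the conjb-2 lineage):
a path (or any ground set `ι`) with kinetic weights `w e t = a e + lam e * t`; a vertex set `ν : Finset ι` has
objective `∑ e ∈ ν, w e t`; along the parametric maximiser ("hull chain") the optimum changes at
breakpoints `t₀ < t₁ < …` by flips `μ ↦ μ ∆ B`.  The located certificate engine (`tightc` / `tightu`, N ≤ 14
exhaustive) prunes its enumeration of candidate chains with necessary conditions of realisability.  This file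
proves those conditions from optimality alone, in the abstract form the engine uses them — every competitor that
the argument needs appears as an explicit hypothesis `objective (competitor) ≤ objective μ` (or `<` where the engine uses the
uniqueness of the optimum at a sample time), so no admissibility structure on `ι` is assumed:

* `gain_eq` : the objective of `μ ∆ B` is that of `μ` plus the signed sum over the block (the gain of the flip;
  sign `-1` for edges leaving, `+1` for edges entering);
* `lone_exit_final` / `lone_entry_first` (N2) : after a lone exit of `e` with `lam e < 0` the edge `e` is never
  in an optimum again; before a lone entry with `0 < lam e` it never was;
* `exchange_consistent` (N4) : two optima cannot express opposite strict/weak preferences between two edges of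
  equal speed via the exchanges `μ - e + f`;
* `undo_lemma` (N5, new in g20) : if the breakpoint at `t₀` flips `B₀ ⊇ A` and the remainder competitor
  `μ₀ ∆ (B₀ \ A)` is not better, then the `A`-part of that gain is `≥ 0` at `t₀`; if its slope is positive, no later
  breakpoint can flip a `B ⊇ A` that reverses `A` while the remainder `μ ∆ (B \ A)` is not better — the remainder
  would have positive gain.  `no_partial_undo` is the case `A = B₀` (slope positivity = the chain is
  slope-increasing).

Located context (not used here): with N5 added to N2 and N4 the exhaustive enumeration for the alphabet {±1,±2}
has no surviving chain with more than N odd blocks for N ≤ 14, without any LP certificate.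
-/

namespace Summit.ValiantsHypothesis.ValiantsHypothesis.Theorems.KPlusLogSqLawHullFacts

open Finset
open scoped symmDiff

variable {ι : Type*} [DecidableEq ι]

/-- the signed `A`-sum (the `A`-part of a gain at state `μ`) is affine in `t`; this names its slope -/
theorem part_linear (a lam : ι → ℚ) (μ A : Finset ι) (t s : ℚ) :
    ∑ e ∈ A, (if e ∈ μ then (-1 : ℚ) else 1) * (a e + lam e * t)
      = ∑ e ∈ A, (if e ∈ μ then (-1 : ℚ) else 1) * (a e + lam e * s)
        + (∑ e ∈ A, (if e ∈ μ then (-1 : ℚ) else 1) * lam e) * (t - s) := by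
  rw [Finset.sum_mul, ← Finset.sum_add_distrib]
  refine Finset.sum_congr rfl fun e _ => ?_
  ring

/-- the signed sum over `B ⊇ A` splits as the signed sum over `A` plus the one over `B \ A` -/
theorem part_add (a lam : ι → ℚ) (μ : Finset ι) {A B : Finset ι} (hAB : A ⊆ B) (t : ℚ) :
    ∑ e ∈ B, (if e ∈ μ then (-1 : ℚ) else 1) * (a e + lam e * t)
      = ∑ e ∈ A, (if e ∈ μ then (-1 : ℚ) else 1) * (a e + lam e * t)
        + ∑ e ∈ B \ A, (if e ∈ μ then (-1 : ℚ) else 1) * (a e + lam e * t) := by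
  rw [← Finset.sum_sdiff hAB]
  ring

/-- if every edge of `A` has opposite membership in `μ` and `μ₀`, the signed `A`-sums at the two states are opposite -/
theorem part_rev (a lam : ι → ℚ) {μ₀ μ A : Finset ι} (hrev : ∀ e ∈ A, (e ∈ μ ↔ e ∉ μ₀)) (t : ℚ) :
    ∑ e ∈ A, (if e ∈ μ then (-1 : ℚ) else 1) * (a e + lam e * t)
      = - ∑ e ∈ A, (if e ∈ μ₀ then (-1 : ℚ) else 1) * (a e + lam e * t) := by
  rw [← Finset.sum_neg_distrib]
  refine Finset.sum_congr rfl fun e he => ?_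
  have h := hrev e he
  by_cases h0 : e ∈ μ₀
  · have h1 : e ∉ μ := fun hm => (h.mp hm) h0
    simp [h0, h1]
  · have h1 : e ∈ μ := h.mpr h0
    simp [h0, h1]

/-- **the gain of a flip**: the objective of `μ ∆ B` is that of `μ` plus the signed sum over `B` -/
theorem gain_eq (a lam : ι → ℚ) (μ B : Finset ι) (t : ℚ) :
    ∑ e ∈ μ ∆ B, (a e + lam e * t)
      = ∑ e ∈ μ, (a e + lam e * t) + ∑ e ∈ B, (if e ∈ μ then (-1 : ℚ) else 1) * (a e + lam e * t) := by
  have hdis : Disjoint (μ \ B) (B \ μ) := disjoint_sdiff_self_right.mono_left sdiff_le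
  rw [symmDiff_def, Finset.sup_eq_union, Finset.sum_union hdis]
  have hμ : ∑ e ∈ μ, (a e + lam e * t)
      = ∑ e ∈ μ \ B, (a e + lam e * t) + ∑ e ∈ μ ∩ B, (a e + lam e * t) := by
    rw [← Finset.sum_union (Finset.disjoint_sdiff_inter μ B), Finset.sdiff_union_inter]
  have hB : ∑ e ∈ B, (if e ∈ μ then (-1 : ℚ) else 1) * (a e + lam e * t)
      = ∑ e ∈ B \ μ, (a e + lam e * t) - ∑ e ∈ μ ∩ B, (a e + lam e * t) := by
    rw [← Finset.sum_filter_add_sum_filter_not B (fun e => e ∈ μ)]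
    have h1 : ∑ e ∈ B.filter (fun e => e ∈ μ), (if e ∈ μ then (-1 : ℚ) else 1) * (a e + lam e * t)
        = ∑ e ∈ B.filter (fun e => e ∈ μ), (-(a e + lam e * t)) := by
      refine Finset.sum_congr rfl fun e he => ?_
      have hm : e ∈ μ := (Finset.mem_filter.mp he).2
      simp [hm]
    have h2 : ∑ e ∈ B.filter (fun e => ¬ e ∈ μ), (if e ∈ μ then (-1 : ℚ) else 1) * (a e + lam e * t)
        = ∑ e ∈ B.filter (fun e => ¬ e ∈ μ), (a e + lam e * t) := by
      refine Finset.sum_congr rfl fun e he => ?_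
      have hm : e ∉ μ := (Finset.mem_filter.mp he).2
      simp [hm]
    rw [h1, h2, Finset.sum_neg_distrib, Finset.filter_mem_eq_inter, ← Finset.sdiff_eq_filter,
      Finset.inter_comm]
    ring
  rw [hμ, hB]
  ring

/-- slopes: the `t`-coefficient version of `gain_eq` -/
theorem slope_gain_eq (lam : ι → ℚ) (μ B : Finset ι) :
    ∑ e ∈ μ ∆ B, lam e = ∑ e ∈ μ, lam e + ∑ e ∈ B, (if e ∈ μ then (-1 : ℚ) else 1) * lam e := by
  have h := gain_eq (fun _ => (0 : ℚ)) lam μ B 1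
  simpa using h

/-- **N5, the undo lemma.**  Breakpoint `t₀`: `μ₀ → μ₀ ∆ B₀` (equal objectives) with the remainder competitor
`μ₀ ∆ (B₀ \ A)` not better, so the signed `A`-sum at state `μ₀` is `≥ 0` at `t₀`; its slope is positive;
breakpoint `t > t₀`: `μ → μ ∆ B` with `A ⊆ B` reversed (every `e ∈ A` has the opposite membership in `μ` and `μ₀`)
and the remainder competitor `μ ∆ (B \ A)` not better.  Impossible: that remainder gains the signed `A`-sum, `> 0`. -/
theorem undo_lemma (a lam : ι → ℚ) {t₀ t : ℚ} (ht : t₀ < t) {μ₀ μ B₀ B A : Finset ι}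
    (hA₀ : A ⊆ B₀) (hA : A ⊆ B)
    (h₀ : ∑ e ∈ μ₀ ∆ B₀, (a e + lam e * t₀) = ∑ e ∈ μ₀, (a e + lam e * t₀))
    (h₀R : ∑ e ∈ μ₀ ∆ (B₀ \ A), (a e + lam e * t₀) ≤ ∑ e ∈ μ₀, (a e + lam e * t₀))
    (hC : 0 < ∑ e ∈ A, (if e ∈ μ₀ then (-1 : ℚ) else 1) * lam e)
    (hrev : ∀ e ∈ A, (e ∈ μ ↔ e ∉ μ₀))
    (h₁ : ∑ e ∈ μ ∆ B, (a e + lam e * t) = ∑ e ∈ μ, (a e + lam e * t))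
    (h₁R : ∑ e ∈ μ ∆ (B \ A), (a e + lam e * t) ≤ ∑ e ∈ μ, (a e + lam e * t)) : False := by
  have g₀ := gain_eq a lam μ₀ B₀ t₀
  have g₀R := gain_eq a lam μ₀ (B₀ \ A) t₀
  have s₀ := part_add a lam μ₀ hA₀ t₀
  have p₀ : 0 ≤ ∑ e ∈ A, (if e ∈ μ₀ then (-1 : ℚ) else 1) * (a e + lam e * t₀) := by linarith
  have lin := part_linear a lam μ₀ A t t₀
  have hpos : 0 < (∑ e ∈ A, (if e ∈ μ₀ then (-1 : ℚ) else 1) * lam e) * (t - t₀) :=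
    mul_pos hC (sub_pos.mpr ht)
  have p₁ : 0 < ∑ e ∈ A, (if e ∈ μ₀ then (-1 : ℚ) else 1) * (a e + lam e * t) := by linarith
  have r := part_rev a lam hrev t
  have g₁ := gain_eq a lam μ B t
  have g₁R := gain_eq a lam μ (B \ A) t
  have s₁ := part_add a lam μ hA t
  linarith

/-- **no partial undo** (the case `A = B₀` of `undo_lemma`, slope positivity = the chain is slope-increasing):
a later breakpoint flip cannot consist of an earlier flip `B₀`, reversed, together with a remainder that is itself
a not-better competitor. -/
theorem no_partial_undo (a lam : ι → ℚ) {t₀ t : ℚ} (ht : t₀ < t) {μ₀ μ B₀ B : Finset ι}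
    (hB : B₀ ⊆ B)
    (h₀ : ∑ e ∈ μ₀ ∆ B₀, (a e + lam e * t₀) = ∑ e ∈ μ₀, (a e + lam e * t₀))
    (hslope : ∑ e ∈ μ₀, lam e < ∑ e ∈ μ₀ ∆ B₀, lam e)
    (hrev : ∀ e ∈ B₀, (e ∈ μ ↔ e ∉ μ₀))
    (h₁ : ∑ e ∈ μ ∆ B, (a e + lam e * t) = ∑ e ∈ μ, (a e + lam e * t))
    (h₁R : ∑ e ∈ μ ∆ (B \ B₀), (a e + lam e * t) ≤ ∑ e ∈ μ, (a e + lam e * t)) : False := by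
  have hC : 0 < ∑ e ∈ B₀, (if e ∈ μ₀ then (-1 : ℚ) else 1) * lam e := by
    have := slope_gain_eq lam μ₀ B₀
    linarith
  refine undo_lemma a lam ht (subset_refl B₀) hB h₀ ?_ hC hrev h₁ h₁R
  have h : μ₀ ∆ (B₀ \ B₀) = μ₀ := by simp
  rw [h]

/-- **N2⁻, lone exits are final.**  If the breakpoint at `t₀` is the lone exit of `e ∈ μ₀` (equal objectives)
and `lam e < 0`, then no later optimum (against dropping `e`) contains `e`. -/
theorem lone_exit_final (a lam : ι → ℚ) {t₀ t : ℚ} (ht : t₀ < t) {e : ι} {μ₀ μ : Finset ι}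
    (he₀ : e ∈ μ₀) (h₀ : ∑ x ∈ μ₀.erase e, (a x + lam x * t₀) = ∑ x ∈ μ₀, (a x + lam x * t₀))
    (hlam : lam e < 0) (he : e ∈ μ)
    (hopt : ∑ x ∈ μ.erase e, (a x + lam x * t) ≤ ∑ x ∈ μ, (a x + lam x * t)) : False := by
  have s₀ := Finset.sum_erase_add μ₀ (fun x => a x + lam x * t₀) he₀
  have s₁ := Finset.sum_erase_add μ (fun x => a x + lam x * t) he
  have w0 : a e + lam e * t₀ = 0 := by
    linarith
  have w1 : 0 ≤ a e + lam e * t := by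
    linarith
  nlinarith [mul_neg_of_neg_of_pos hlam (sub_pos.mpr ht)]

/-- **N2⁺, lone entries are first moves.**  If the breakpoint at `t₀` is the lone entry of `e ∉ μ₀` (equal
objectives) and `0 < lam e`, then no earlier optimum (against dropping `e`) contains `e`. -/
theorem lone_entry_first (a lam : ι → ℚ) {t₀ t : ℚ} (ht : t < t₀) {e : ι} {μ₀ μ : Finset ι}
    (he₀ : e ∉ μ₀) (h₀ : ∑ x ∈ insert e μ₀, (a x + lam x * t₀) = ∑ x ∈ μ₀, (a x + lam x * t₀))
    (hlam : 0 < lam e) (he : e ∈ μ)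
    (hopt : ∑ x ∈ μ.erase e, (a x + lam x * t) ≤ ∑ x ∈ μ, (a x + lam x * t)) : False := by
  have s₀ := Finset.sum_insert (f := fun x => a x + lam x * t₀) he₀
  have s₁ := Finset.sum_erase_add μ (fun x => a x + lam x * t) he
  have w0 : a e + lam e * t₀ = 0 := by
    linarith
  have w1 : 0 ≤ a e + lam e * t := by
    linarith
  nlinarith [mul_pos hlam (sub_pos.mpr ht)]

/-- **N4, exchange consistency.**  Two optima cannot express opposite (one strict, one weak) preferences between
two edges `e`, `f` of equal speed via the single exchanges `μ - e + f`, `μ - f + e` (the strict one is the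
uniqueness of the optimum at a sample time; admissibility of the exchanged sets is the caller's business). -/
theorem exchange_consistent (a lam : ι → ℚ) {e f : ι} (hlam : lam e = lam f) {t₁ t₂ : ℚ}
    {μ₁ μ₂ : Finset ι} (he₁ : e ∈ μ₁) (hf₁ : f ∉ μ₁) (hf₂ : f ∈ μ₂) (he₂ : e ∉ μ₂)
    (h₁ : ∑ x ∈ insert f (μ₁.erase e), (a x + lam x * t₁) < ∑ x ∈ μ₁, (a x + lam x * t₁))
    (h₂ : ∑ x ∈ insert e (μ₂.erase f), (a x + lam x * t₂) ≤ ∑ x ∈ μ₂, (a x + lam x * t₂)) : False := by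
  have hf₁' : f ∉ μ₁.erase e := fun h => hf₁ (Finset.mem_of_mem_erase h)
  have he₂' : e ∉ μ₂.erase f := fun h => he₂ (Finset.mem_of_mem_erase h)
  rw [Finset.sum_insert hf₁'] at h₁
  rw [Finset.sum_insert he₂'] at h₂
  have s₁ := Finset.sum_erase_add μ₁ (fun x => a x + lam x * t₁) he₁
  have s₂ := Finset.sum_erase_add μ₂ (fun x => a x + lam x * t₂) hf₂
  have i₁ : a f + lam f * t₁ < a e + lam e * t₁ := by
    linarith
  have i₂ : a e + lam e * t₂ ≤ a f + lam f * t₂ := by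
    linarith
  rw [hlam] at i₁ i₂
  linarith

end Summit.ValiantsHypothesis.ValiantsHypothesis.Theorems.KPlusLogSqLawHullFacts
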